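import Summits.ResolutionOfSingularities.ResolutionOfSingularities.Theorems.MarkedTransferCampaignW46ThreefoldsGammaFreeGlobal
import HarnessLib

/-!
# [OURS · L1 W4.6 rung (ii)] GLOBALITY ANCHORS for `CampaignW46.IsPermissibleBlowupSeq`: integral stages, non-zero
# transforms, SURJECTIVITY of the composite (proofs only; companion of the #86-repair statement module)

Cell res-hironaka, LADDER-RESOLUTION rung L (D-0089), slot W4.6, rung (ii); typer res-L1-type-o1 (statement-only lane —
these are structural facts about the OURS predicate typed in `…ThreefoldsGammaFreeGlobal.lean` (p493059), not results about
resolution). `--kind proof --supports stmt-ResolutionOfSingularities-16156 --as helper`. OURS-desk #86 lane B (res-ref-b2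
2026-08-27T03:19:15Z) asked that the repaired Γ-free shadow carry «an LSB predicate without restrict (IsMultipleBlowup-style)
OR surjectivity/properness of Φ onto X»; the statement module took the first; this file shows the second FOLLOWS from it
for the inputs of `GammaFreeGlobalOrderReductionDimLeThree` (integral regular `X`, `I ≠ 0`, `m ≥ 1`): along a sequence of
permissible blowing-ups every stage is integral, every transform is non-zero, and the composite is surjective
(`IsPermissibleBlowupSeq.isIntegral_and_ne_bot_and_surjective`, `.surjective`; properness is `.isProper` in the
statement module). In particular the vacuous witness `X′ = ∅` of the bounced `GammaFreeOrderReductionDimLeThree` is not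
available to the repaired statement. Tree tools: `IsBlowup.isIntegral` [Stacks 02ND], `IsBlowup.isIso_compl`
[Stacks 02OS], `IsBlowup.isProper` [Stacks 02NS], `comap_le_controlledTransform`, Mathlib
`Surjective.of_universallyClosed_of_isDominant`. Nothing of H. Hironaka's manuscript is used or asserted. AI-written;
AI review is weaker than expert review. [Hironaka2017] — scope only.
-/

noncomputable section

set_option linter.dupNamespace false -- mandated namespace of this single-conjunct summit

open CategoryTheory AlgebraicGeometry TopologicalSpace

namespace Summit.ResolutionOfSingularities.ResolutionOfSingularities.Theorems

namespace CampaignW46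

open Literature.AlgebraicGeometry.Resolution
open Scheme.IdealSheafData
open Literature.AlgebraicGeometry.Hironaka2017

universe u

/-! ## Integral stages, non-zero transforms, surjectivity -/

namespace IsPermissibleBlowupSeq

variable {Z : Scheme.{u}} {J : Z.IdealSheafData} {b : ℕ}

/-- On an integral scheme the generic point is off the support of a non-zero ideal sheaf (cf. tree
`Resolution.not_mem_support_genericPoint`, restated privately to keep this module's imports light). [folklore] -/
private theorem genericPoint_notMem_support {X : Scheme.{u}} [IsIntegral X] {K : X.IdealSheafData} (hK : K ≠ ⊥) :
    genericPoint X ∉ K.support := by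
  intro h
  apply hK
  rw [← Scheme.IdealSheafData.support_eq_top_iff, ← top_le_iff]
  intro x _
  have := (genericPoint_spec X).mem_closed_set_iff K.support.isClosed
  exact (this.mp h) (Set.mem_univ x)

/-- **GLOBALITY OF A SEQUENCE OF PERMISSIBLE BLOWING-UPS.** Over an INTEGRAL regular locally Noetherian `Z`, for `J ≠ 0`
and `b ≥ 1`: the last stage `Z′` is integral, the last transform `J′` is non-zero, and `σ : Z′ → Z` is SURJECTIVE.
Induction on the sequence: a permissible centre `D ⊆ {b ≤ ord J_i}` misses the generic point `η` of the integral stage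
(`ord_η J_i = 0` as `J_i ≠ 0`), so `𝓘(D) ≠ 0` and the blow-up is again integral (tree `IsBlowup.isIntegral`); `J_i 𝒪 ≠ 0`
(the blow-up is an isomorphism over `Z_i ∖ D ∋ η`, tree `IsBlowup.isIso_compl`) and `J_i 𝒪 ⊆ J_{i+1}`
(`comap_le_controlledTransform`); the blow-up is proper (`IsBlowup.isProper`) and dominant (its image contains `η`), hence
surjective (Mathlib `Surjective.of_universallyClosed_of_isDominant`). Together with `isProper` this is the full globality
clause «`Φ` proper and surjective onto `X`» of OURS-desk #86 lane B, as a CONSEQUENCE of the localisation-free predicate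
for the inputs of `GammaFreeGlobalOrderReductionDimLeThree`. [folklore] -/
theorem isIntegral_and_ne_bot_and_surjective :
    ∀ {Z' : Scheme.{u}} {σ : Z' ⟶ Z} {J' : Z'.IdealSheafData}, IsPermissibleBlowupSeq J b σ J' →
      IsIntegral Z → IsLocallyNoetherian Z → Scheme.IsRegular Z → J ≠ ⊥ → 1 ≤ b →
        IsIntegral Z' ∧ J' ≠ ⊥ ∧ Surjective σ := by
  intro Z' σ J' h hint hN hR hJ hb
  induction h with
  | nil => exact ⟨hint, hJ, inferInstance⟩
  | @blowup Z'' Z' σ J' h D π hreg hD hπ ih =>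
    obtain ⟨hint', hJ', hsurj⟩ := ih
    haveI := hint'
    haveI : IsLocallyNoetherian Z' := (h.isLocallyNoetherian_and_isRegular hN hR).1
    -- the generic point of the stage is off the centre
    have hη : genericPoint Z' ∉ (D : Set Z') := fun hηD => by
      have h1 : (1 : ℕ∞) ≤ idealOrder J' (genericPoint Z') := le_trans (by exact_mod_cast hb) (hD _ hηD)
      exact genericPoint_notMem_support hJ' ((one_le_idealOrder_iff J' _).mp h1)
    have hCtop : (vanishingIdeal D).support ≠ ⊤ := fun htop => hη (by
      have hmem : genericPoint Z' ∈ ((vanishingIdeal D).support : Set Z') := by rw [htop]; trivial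
      rwa [coe_support_vanishingIdeal] at hmem)
    have hCne : vanishingIdeal D ≠ ⊥ := fun hbot => hCtop (by rw [hbot, Scheme.IdealSheafData.support_bot])
    haveI : IsIntegral Z'' := hπ.isIntegral hCne
    -- a preimage of the generic point (the blow-up is an isomorphism off the centre)
    set W₀ : Z'.Opens := ⟨((vanishingIdeal D).support : Set Z')ᶜ, (vanishingIdeal D).support.isClosed.isOpen_compl⟩
      with hW₀
    haveI : IsIso (π ∣_ W₀) := hπ.isIso_compl
    have hηW : genericPoint Z' ∈ W₀ := by
      change genericPoint Z' ∈ ((vanishingIdeal D).support : Set Z')ᶜ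
      rw [coe_support_vanishingIdeal]
      exact hη
    obtain ⟨ξ', hξ'⟩ := (ConcreteCategory.bijective_of_isIso ((π ∣_ W₀).base)).2 ⟨genericPoint Z', hηW⟩
    have hπξ' : π ξ'.1 = genericPoint Z' := by
      have := congrArg Subtype.val hξ'
      rwa [morphismRestrict_base_coe] at this
    -- the transform is non-zero
    have hcomap : J'.comap π ≠ ⊥ := by
      intro hbot
      have hmem : ξ'.1 ∈ (J'.comap π).support := by rw [hbot, Scheme.IdealSheafData.support_bot]; trivial
      rw [Scheme.IdealSheafData.support_comap] at hmem
      exact genericPoint_notMem_support hJ' (hπξ' ▸ hmem)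
    have hJ'' : controlledTransform π (vanishingIdeal D) J' b ≠ ⊥ := fun hbot =>
      hcomap (le_bot_iff.mp (hbot ▸ comap_le_controlledTransform π (vanishingIdeal D) J' b))
    -- surjectivity: proper and dominant
    haveI : IsProper π := hπ.isProper
    haveI : IsDominant π := ⟨Dense.mono
      (show ({genericPoint Z'} : Set Z') ⊆ Set.range π by rintro _ rfl; exact ⟨ξ'.1, hπξ'⟩)
      (by rw [dense_iff_closure_eq, genericPoint_closure])⟩
    haveI : Surjective π := inferInstance
    haveI := hsurj
    exact ⟨inferInstance, hJ'', inferInstance⟩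

/-- In particular `σ` is surjective on points. [folklore] -/
theorem surjective {Z' : Scheme.{u}} {σ : Z' ⟶ Z} {J' : Z'.IdealSheafData} (h : IsPermissibleBlowupSeq J b σ J')
    [IsIntegral Z] [IsLocallyNoetherian Z] (hR : Scheme.IsRegular Z) (hJ : J ≠ ⊥) (hb : 1 ≤ b) :
    Function.Surjective σ := by
  haveI := (h.isIntegral_and_ne_bot_and_surjective inferInstance inferInstance hR hJ hb).2.2
  exact σ.surjective

end IsPermissibleBlowupSeq

end CampaignW46

end Summit.ResolutionOfSingularities.ResolutionOfSingularities.Theorems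

end
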